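import Summits.ResolutionOfSingularities.ResolutionOfSingularities.Theorems.EquisingularLiftEquisingularLiftNatSecCurveCartier
import Summits.ResolutionOfSingularities.ResolutionOfSingularities.Theorems.EquisingularLiftEquisingularLiftNatSectionRoundLiftRegular
import Summits.ResolutionOfSingularities.ResolutionOfSingularities.Theorems.EquisingularLiftEquisingularLiftNatEmbeddedCurveLiftOfFact
import Summits.ResolutionOfSingularities.ResolutionOfSingularities.Theorems.EquisingularLiftEquisingularLiftNatDoorFactsHold
import HarnessLib

/-!
# EL♮(3), WIDTH TABLE W₂ «Σ-SECTION ROUND» (desk R73/R73d), brick (B): THE LIFT LICENCE OF THE SECTION ROUND — a centre `C ⊇ 𝓔` on the stage,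
# REGULAR, `O`-flat, with exact reduced trace `C·𝒪_G = 𝓘⟨Z⟩`, for a curve `Z` cut on the host `E` by ONE PARAMETER (letter (L2))

res-L1-w45b-nose-w1 g6 (WIDTH seat D-0157 DOOR 1; R73d owner of `TCPlus.hround_sec`, this is its brick (B); (A) = ✓ p708682 `…NatSecCurveCartier`,
(u2) = ✓ p707813 `…NatSectionRoundLiftRegular`).  The door (res-type-027 ✓ `…NatResidueHypDefs11` / slot `HRoundSecSupplier`, ✓ p707925) replaces the
nodal round's «`Ẽ` regular along `Z̃`» + (N4) by the letter (L2) «`𝓘⟨Z⟩_z = 𝓘⟨E⟩_z + (f)`, `f ∉ 𝓘⟨E⟩_z + 𝔪_z²` at every closed `z ∈ Z`».  The licence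
is then UNCONDITIONAL and needs no first-order choice: ✓ `embeddedLiftFact_holds` (Hartshorne 2010 Thm. 22.3 in the chain's currency, hypothesis-free
since E♭) applied to the local complete intersection `ι : Z̃ ⟶ Ẽ` (✓ (A) `SecCurve.exists_affineOpens_isWeaklyRegular_ker`, from (L2), (D1), (D2) and the
host's regular model) inside the proper flat ambient `W = V(𝓔) → Spec O`, with the Čech datum `DirStepUnobs`; the `O`-flat lift `C₀` with
`C₀·𝒪_{Ẽ} = 𝓘_{Z̃}` is pushed to the stage as `C := C₀.map (V(𝓔) ↪ X)` exactly as in ✓ P0 `embeddedCurveLiftFact_of_embeddedLiftFact_of_lci`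
(`𝓔 ≤ C`, flatness and properness through `V(C) ≅ V(C₀)`, `C·𝒪_G = 𝓘⟨Z⟩` by pasting cartesian squares); and `V(C)` is REGULAR by ✓ (u2)
`SectionLift.isRegular_subscheme_of_paramLift` — (L2) read through the traces `C·𝒪_G = 𝓘⟨Z⟩`, `𝓔·𝒪_G = 𝓘⟨E⟩` says the lift is cut on the regular
`V(𝓔)` by one regular parameter at every closed special point.

* ★ `SecCurve.exists_sectionCentre` — the licence, binders in the order of ✓ `NodalCurveLiftAt` ((N1)/(N4)/«regular along» ↦ (D2) + (L2)), plus
  `[CompactSpace G]` (the special fibre of a proper stage; used for «closed points suffice» in (A)); conclusion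
  `∃ C, 𝓔 ≤ C ∧ Scheme.IsRegular C.subscheme ∧ Flat (C.subschemeι ≫ σ ≫ q) ∧ C.comap j = 𝓘⟨Z⟩`.
* ★ `SecCurve.secCurveLift (k)` — the same in the SLOT shape of res-L1-w45b-stub-2 g20's ✓ `TCPlus.hround_sec_of_secCurveLift` (binder text
  0196e0c85d2c112d verbatim), so that the cap `TCPlus.hround_sec k := TCPlus.hround_sec_of_secCurveLift k (SecCurve.secCurveLift k)` is one line
  (…NatHRoundSecSupplier, this seat; desk R74 (iv)).

DEF-FREE; no `sorry`; standard axioms; `--supports stmt-ResolutionOfSingularities-20148 --as helper`, counted 0.  EL♮(3) is NOT proved; resolution of singularities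
in positive characteristic is NOT proved anywhere in this tree (dim 3 in print: Cossart–Piltant 2008/2009); nothing of [Hironaka2017] is asserted.
References (method only): R. Hartshorne, *Deformation Theory* (2010), Thm. 22.3; H. Matsumura, *Commutative Ring Theory* (1986), Thm. 14.2, 23.7.
-/

set_option linter.dupNamespace false -- mandated namespace `Summit.<Summit>.<Problem>` of this single-conjunct summit

noncomputable section

open CategoryTheory CategoryTheory.Limits AlgebraicGeometry TopologicalSpace IsLocalRing
open Literature.AlgebraicGeometry.Resolution
open AlgebraicGeometry.Scheme.IdealSheafData
open Summit.ResolutionOfSingularities.ResolutionOfSingularities.Cruxes.EquisingularLift.StrataSplit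

namespace Summit.ResolutionOfSingularities.ResolutionOfSingularities.Cruxes.EquisingularLiftNat.Sections.SecCurve

open Summit.ResolutionOfSingularities.ResolutionOfSingularities.Cruxes.EquisingularLiftNat.Sections

/-- ★ **THE LIFT LICENCE OF THE Σ-SECTION ROUND** (W₂ brick (B)).  `O` a complete DVR with a surjection `θ : O → k` onto a field; a stage `σ : X ⟶ P`
over `q : P ⟶ Spec O`, `X` locally Noetherian, with model square `(j, t)` over `θ` whose special fibre `G` is quasi-compact; an exceptional surface
`𝓔` with `V(𝓔)` REGULAR, `O`-flat and proper and reduced trace `𝓔·𝒪_G = 𝓘⟨E⟩`; a closed `Z ⊆ E` with (D1) `dim 𝒪_{Z̃,z} = 1` and (D2) `dim 𝒪_{Ẽ,i z} = 2`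
at closed `z`, the letter (L2) at every closed `z ∈ Z`, and the Čech datum `DirStepUnobs G E hE Z hZ`.  THEN there is a centre `C ⊇ 𝓔` on `X` with
`V(C)` REGULAR and `O`-FLAT and `C·𝒪_G = 𝓘⟨Z⟩`.  (✓ `embeddedLiftFact_holds` on the lci `Z̃ ⊆ Ẽ` of ✓ (A); transport as ✓ P0; regularity by ✓ (u2).)
[OURS · L1 W4.5b · W₂ brick (B); counted 0; nothing of EL♮(3) is proved here] -/
theorem exists_sectionCentre (O : Type) [CommRing O] [IsDomain O] [IsDiscreteValuationRing O] [IsAdicComplete (maximalIdeal O) O]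
    (k : Type) [Field k] (θ : O →+* k) (hθ : Function.Surjective θ) {P : Scheme.{0}} (X : Scheme.{0}) (σ : X ⟶ P) (q : P ⟶ Spec (.of O))
    (𝓔 : X.IdealSheafData) [IsLocallyNoetherian X] (h𝓔reg : Scheme.IsRegular 𝓔.subscheme) [Flat (𝓔.subschemeι ≫ σ ≫ q)]
    [IsProper (𝓔.subschemeι ≫ σ ≫ q)] (G : Scheme.{0}) [CompactSpace G] (j : G ⟶ X) (t : G ⟶ Spec (.of k))
    (hsq : IsPullback j t (σ ≫ q) (Spec.map (CommRingCat.ofHom θ)))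
    (E : Set G) (hE : IsClosed E) (h𝓔E : 𝓔.comap j = vanishingIdeal (⟨E, hE⟩ : Closeds G)) (Z : Set G) (hZ : IsClosed Z) (hZE : Z ⊆ E)
    (hZdim : ∀ z : ↥(redSub G Z hZ), IsClosed ({z} : Set ↥(redSub G Z hZ)) →
      ringKrullDim ((redSub G Z hZ).presheaf.stalk z) = ((1 : ℕ) : WithBot ℕ∞))
    (hEdim : ∀ (i : redSub G Z hZ ⟶ redSub G E hE), i ≫ redSubι G E hE = redSubι G Z hZ →
      ∀ z : ↥(redSub G Z hZ), IsClosed ({z} : Set ↥(redSub G Z hZ)) →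
        ringKrullDim ((redSub G E hE).presheaf.stalk (i z)) = ((2 : ℕ) : WithBot ℕ∞))
    (hL2 : ∀ z ∈ Z, IsClosed ({z} : Set G) → ∃ f : G.presheaf.stalk z,
      stalkIdeal (vanishingIdeal (⟨Z, hZ⟩ : Closeds G)) z = stalkIdeal (vanishingIdeal (⟨E, hE⟩ : Closeds G)) z ⊔ Ideal.span {f} ∧
        f ∉ stalkIdeal (vanishingIdeal (⟨E, hE⟩ : Closeds G)) z ⊔ maximalIdeal (G.presheaf.stalk z) ^ 2)
    (hunobs : DirStepUnobs G E hE Z hZ) :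
    ∃ C : X.IdealSheafData, 𝓔 ≤ C ∧ Scheme.IsRegular C.subscheme ∧ Flat (C.subschemeι ≫ σ ≫ q) ∧
      C.comap j = vanishingIdeal (⟨Z, hZ⟩ : Closeds G) := by
  -- adapted from ✓ P0 `embeddedCurveLiftFact_of_embeddedLiftFact_of_lci` (…NatEmbeddedCurveLiftOfFact, res-type-027 g16)
  classical
  haveI : IsLocallyNoetherian G := P1VB.isLocallyNoetherian_of_modelSquare θ hθ (σ ≫ q) j t hsq
  -- the ambient of (F): `W = V(𝓔)` over `Spec O`
  set w : 𝓔.subscheme ⟶ Spec (.of O) := 𝓔.subschemeι ≫ σ ≫ q with hw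
  haveI : IsLocallyNoetherian 𝓔.subscheme := LocallyOfFiniteType.isLocallyNoetherian 𝓔.subschemeι
  -- the closed immersion downstairs: `ι : Z̃ ⟶ Ẽ`
  have hle : vanishingIdeal (⟨E, hE⟩ : Closeds G) ≤ vanishingIdeal (⟨Z, hZ⟩ : Closeds G) :=
    vanishingIdeal_antimono (show (⟨Z, hZ⟩ : Closeds G) ≤ ⟨E, hE⟩ from hZE)
  let ι : redSub G Z hZ ⟶ redSub G E hE := inclusion hle
  have hιfac : ι ≫ redSubι G E hE = redSubι G Z hZ := inclusion_subschemeι hle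
  haveI : IsClosedImmersion ι :=
    @IsClosedImmersion.of_comp_isClosedImmersion _ _ _ ι (redSubι G E hE) inferInstance (by rw [hιfac]; infer_instance)
  haveI : IsLocallyNoetherian (redSub G E hE) := LocallyOfFiniteType.isLocallyNoetherian (redSubι G E hE)
  -- (P1) the model square of `W` with special fibre `Ẽ`
  let e' : redSub G E hE ⟶ (𝓔.comap j).subscheme := inclusion h𝓔E.le
  let e'' : (𝓔.comap j).subscheme ⟶ redSub G E hE := inclusion h𝓔E.ge
  have he₁ : e' ≫ e'' = 𝟙 _ := by
    simp only [e', e'', inclusion_comp]; exact inclusion_id _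
  have he₂ : e'' ≫ e' = 𝟙 _ := by
    simp only [e', e'', inclusion_comp]; exact inclusion_id _
  haveI : IsIso e' := ⟨e'', he₁, he₂⟩
  let jW : redSub G E hE ⟶ 𝓔.subscheme := e' ≫ subschemeComapHom j 𝓔
  let tW : redSub G E hE ⟶ Spec (.of k) := redSubι G E hE ≫ t
  have hsqE : IsPullback (subschemeComapHom j 𝓔) ((𝓔.comap j).subschemeι ≫ t) w (Spec.map (CommRingCat.ofHom θ)) := by
    rw [hw]; exact (isPullback_subschemeComapHom j 𝓔).paste_vert hsq
  have hsq₀ : IsPullback e' tW ((𝓔.comap j).subschemeι ≫ t) (𝟙 _) :=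
    IsPullback.of_horiz_isIso ⟨by simp only [tW, Category.comp_id, e']; rw [← Category.assoc, inclusion_subschemeι]⟩
  have hsqW : IsPullback jW tW w (Spec.map (CommRingCat.ofHom θ)) := by
    simpa only [Category.id_comp] using hsq₀.paste_horiz hsqE
  -- the square `Ẽ → V(𝓔)` over `j : G → X`
  have hsqj₀ : IsPullback e' (redSubι G E hE) (𝓔.comap j).subschemeι (𝟙 G) :=
    IsPullback.of_horiz_isIso ⟨by simp only [Category.comp_id, e']; exact inclusion_subschemeι _⟩
  have hsqj : IsPullback jW (redSubι G E hE) 𝓔.subschemeι j := by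
    simpa only [Category.id_comp] using hsqj₀.paste_horiz (isPullback_subschemeComapHom j 𝓔)
  -- (P2) = ✓ (A): `Z̃ ⊆ Ẽ` is a local complete intersection (one parameter, a non-zero-divisor); and the Čech datum from `DirStepUnobs`
  have hlci := exists_affineOpens_isWeaklyRegular_ker O θ hθ hZ hE w jW tW hsqW h𝓔reg ι hιfac (hEdim ι hιfac) hZdim hL2
  have hH1 := hunobs ι hιfac
  -- apply (F) — a THEOREM (✓ `embeddedLiftFact_holds`)
  obtain ⟨C₀, hC₀flat, hC₀comap⟩ :=
    embeddedLiftFact_holds O k θ hθ 𝓔.subscheme w (redSub G E hE) jW tW hsqW inferInstance inferInstance (redSub G Z hZ) ι inferInstance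
      hlci hH1
  -- (P3) transport to the stage
  let f : C₀.subscheme ⟶ X := C₀.subschemeι ≫ 𝓔.subschemeι
  let C : X.IdealSheafData := C₀.map 𝓔.subschemeι
  have hCf : C = f.ker := rfl
  -- the lift `Z̃ → V(C₀)` and its cartesian squares
  have hker : C₀.subschemeι.ker ≤ (ι ≫ jW).ker := by
    rw [ker_subschemeι, ← map_ker, ← hC₀comap]; exact le_map_comap _ _
  let l : redSub G Z hZ ⟶ C₀.subscheme := IsClosedImmersion.lift C₀.subschemeι (ι ≫ jW) hker
  have hlfac : l ≫ C₀.subschemeι = ι ≫ jW := IsClosedImmersion.lift_fac _ _ _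
  have hsql : IsPullback ι l jW C₀.subschemeι :=
    isPullback_of_isClosedImmersion ι C₀.subschemeι l jW hlfac.symm (by rw [ker_subschemeι, hC₀comap])
  -- `Z̃ = V(C₀) ×_X G`
  have hsqG : IsPullback l (ι ≫ redSubι G E hE) f j := hsql.flip.paste_vert hsqj
  haveI : IsProper (C₀.subschemeι ≫ w) := inferInstance
  haveI : Flat (C₀.subschemeι ≫ w) := hC₀flat
  haveI hfci : IsClosedImmersion f := IsClosedImmersion.comp C₀.subschemeι 𝓔.subschemeι
  haveI : IsIso f.toImage := by infer_instance
  have h𝓔C : 𝓔 ≤ C :=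
    calc 𝓔 = (⊥ : 𝓔.subscheme.IdealSheafData).map 𝓔.subschemeι := by rw [Scheme.IdealSheafData.map_bot, ker_subschemeι]
      _ ≤ C := map_mono _ bot_le
  have h1 : f.toImage ≫ C.subschemeι ≫ σ ≫ q = C₀.subschemeι ≫ w := by
    change f.toImage ≫ f.imageι ≫ σ ≫ q = _
    rw [f.toImage_imageι_assoc, hw]; simp only [f, Category.assoc]
  haveI hCflat : Flat (C.subschemeι ≫ σ ≫ q) := by
    have h2 : Flat (f.toImage ≫ C.subschemeι ≫ σ ≫ q) := by rw [h1]; exact hC₀flat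
    exact (MorphismProperty.cancel_left_of_respectsIso @Flat f.toImage _).mp h2
  haveI hCprop : IsProper (C.subschemeι ≫ σ ≫ q) := by
    have h2 : IsProper (f.toImage ≫ C.subschemeι ≫ σ ≫ q) := by rw [h1]; infer_instance
    exact (MorphismProperty.cancel_left_of_respectsIso @IsProper f.toImage _).mp h2
  have hCj : C.comap j = vanishingIdeal (⟨Z, hZ⟩ : Closeds G) := by
    rw [hCf, ← ker_fst_of_isClosedImmersion f j, ← hsqG.flip.isoPullback_inv_fst, Scheme.Hom.ker_comp_of_isIso, hιfac,
      ker_subschemeι]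
  -- (u2) `V(C)` is regular: (L2) read through the traces
  have hCreg : Scheme.IsRegular C.subscheme := by
    refine SectionLift.isRegular_subscheme_of_paramLift O k θ hθ (σ ≫ q) j t hsq 𝓔 C h𝓔C h𝓔reg ?_
    intro z₀ hz₀ hz₀c
    rw [hCj, Scheme.IdealSheafData.coe_support_vanishingIdeal] at hz₀
    rw [hCj, h𝓔E]
    exact hL2 z₀ hz₀ hz₀c
  exact ⟨C, h𝓔C, hCreg, hCflat, hCj⟩

set_option linter.overlappingInstances false in -- the slot's text carries `[IsDomain O] [IsDiscreteValuationRing O]` (verbatim binder)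
/-- ★ **THE Σ-LICENCE IN THE SLOT'S SHAPE** — res-L1-w45b-stub-2 g20's binder `hSL` of ✓ `TCPlus.hround_sec_of_secCurveLift` (…NatHRoundSecOfLicence;
binder text `HRoundSec-licence-binder.txt` 0196e0c85d2c112d, desk R74 (iv)) VERBATIM: `NodalCurveLiftAt`'s binders closed over `(O θ P X σ q 𝓔)` with
(N2)/(N4) replaced by (D2)/(L2), the frame clause dropped, and the call site's spare antecedents (`X` integral and regular, `σ ≫ q` proper, principal
stalks, `𝓔 ≠ ⊥`, (N1), algebraically closed residue field) kept in the text; inhabited by `exists_sectionCentre` (the special fibre of the proper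
`σ ≫ q` is quasi-compact by base change).  So `TCPlus.hround_sec k := TCPlus.hround_sec_of_secCurveLift k (secCurveLift k)`.
[OURS · L1 W4.5b · W₂ brick (B), slot form; counted 0] -/
theorem secCurveLift (k : Type) [Field k] :
    ∀ (O : Type) [CommRing O] [IsDomain O] [IsDiscreteValuationRing O] [IsAdicComplete (maximalIdeal O) O]
        [IsAlgClosed (ResidueField O)] (θ : O →+* k), Function.Surjective θ →
      ∀ {P : Scheme.{0}} (X : Scheme.{0}) (σ : X ⟶ P) (q : P ⟶ Spec (.of O)) (𝓔 : X.IdealSheafData),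
        IsIntegral X → IsLocallyNoetherian X → Scheme.IsRegular X → IsProper (σ ≫ q) →
        (∀ x : X, (stalkIdeal 𝓔 x).IsPrincipal) → 𝓔 ≠ ⊥ →
        Scheme.IsRegular 𝓔.subscheme → Flat (𝓔.subschemeι ≫ σ ≫ q) → IsProper (𝓔.subschemeι ≫ σ ≫ q) →
        ∀ (G : Scheme.{0}) (j : G ⟶ X) (t : G ⟶ Spec (.of k)),
          IsPullback j t (σ ≫ q) (Spec.map (CommRingCat.ofHom θ)) →
          ∀ (E : Set G) (hE : IsClosed E), 𝓔.comap j = vanishingIdeal (⟨E, hE⟩ : Closeds G) →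
          ∀ (Z : Set G) (hZ : IsClosed Z), Z ⊆ E →
            Set.Finite {x : ↥(redSub G Z hZ) | ¬ IsRegularLocalRing ((redSub G Z hZ).presheaf.stalk x)} →
            (∀ z : ↥(redSub G Z hZ), IsClosed ({z} : Set ↥(redSub G Z hZ)) →
              ringKrullDim ((redSub G Z hZ).presheaf.stalk z) = ((1 : ℕ) : WithBot ℕ∞)) →
            (∀ (i : redSub G Z hZ ⟶ redSub G E hE), i ≫ redSubι G E hE = redSubι G Z hZ →
              ∀ z : ↥(redSub G Z hZ), IsClosed ({z} : Set ↥(redSub G Z hZ)) →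
                ringKrullDim ((redSub G E hE).presheaf.stalk (i z)) = ((2 : ℕ) : WithBot ℕ∞)) →
            (∀ z ∈ Z, IsClosed ({z} : Set G) → ∃ f : G.presheaf.stalk z,
              stalkIdeal (vanishingIdeal (⟨Z, hZ⟩ : Closeds G)) z =
                  stalkIdeal (vanishingIdeal (⟨E, hE⟩ : Closeds G)) z ⊔ Ideal.span {f} ∧
                f ∉ stalkIdeal (vanishingIdeal (⟨E, hE⟩ : Closeds G)) z ⊔ (maximalIdeal (G.presheaf.stalk z)) ^ 2) →
            DirStepUnobs G E hE Z hZ →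
            ∃ C : X.IdealSheafData, 𝓔 ≤ C ∧ Scheme.IsRegular C.subscheme ∧ Flat (C.subschemeι ≫ σ ≫ q) ∧
              C.comap j = vanishingIdeal (⟨Z, hZ⟩ : Closeds G) := by
  intro O _ _ _ _ _ θ hθ P X σ q 𝓔 _ hXnoeth _ hσq _ _ h𝓔reg h𝓔fl h𝓔prop G j t hsq E hE h𝓔E Z hZ hZE _ hZdim hEdim hL2 hunobs
  haveI := hXnoeth; haveI := h𝓔fl; haveI := h𝓔prop; haveI := hσq
  -- the special fibre of the proper `σ ≫ q` is quasi-compact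
  haveI : QuasiCompact t := MorphismProperty.of_isPullback hsq (inferInstance : QuasiCompact (σ ≫ q))
  haveI : CompactSpace ↥G := QuasiCompact.compactSpace_of_compactSpace t
  exact exists_sectionCentre O k θ hθ X σ q 𝓔 h𝓔reg G j t hsq E hE h𝓔E Z hZ hZE hZdim hEdim hL2 hunobs

end Summit.ResolutionOfSingularities.ResolutionOfSingularities.Cruxes.EquisingularLiftNat.Sections.SecCurve

end
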